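import Summits.QuantumFields.YangMills.Theorems.UnitScaleTiltProp7TwistedSliceTangent
import Summits.QuantumFields.YangMills.Theorems.UnitScaleTiltProp7SymAvgTwSymSlice
import HarnessLib

/-!
# Route `UnitScaleTilt`, crux K1 child «MinimiserStabilityRegPr» (stmt-QuantumFields-19200), skeleton v10, stub `stub_existenceMinimalOrbit` (EX), route (α) — **THE CONVERSE HALF OF THE
# `hsplit` TRANSPORT, REDUCED TO ONE SOLVED EQUATION: `ker QSym(U′) ⊆ M·𝒯_{A₁} + 𝒢_{U′}` AS SOON AS THE FRAME-CORRECTED GAUGE EQUATION `𝓚_{A₁}(N) = −λ_{M⁻¹ξ}` IS SOLVED** (brick T4 of the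
# chart-side TRANSPORT of `hXtw‴`(iii); junction ★★`Prop7TangentCriticalSplit.tangentCritical_su2_of_split` (`W := U′`, `Ker := ker QSym U′`); LOCATE memo `LOCATE-TRANSPORT-LIN-w5g6.md` (R-𝓚), and
# the by-name split «`hSplit` = (P1) + (P2)» (bus 2026-08-28 15:1xZ)).

Cell `ym3-torus`, width seat `ym-ust-20520-w5` (gen 6).  THEOREMS ONLY (0 `def`, 0 `sorry`).  `--supports stmt-QuantumFields-19200 --as helper`, count-neutral.  YM₃ on T³ is a ladder rung (R3), not
the Clay problem; nothing here claims the stub, the crux, d = 4 or the mass gap.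

THE POINT.  T3 (✓`Prop7TwistedSliceGaugeCorrection`) proved the inclusion `M(𝒯_{A₁}) ⊆ ker QSym(U′) + 𝒢_{U′}` (`𝒯_{A₁} := ker D(logChartTwS U₀)(A₁)`, `M := g(ad(−A₁))` the velocity map,
`𝒢_{U′} := {G_{U′}N = (b ↦ N(b₋) − U′♭(b)N(b₊)U′♭(b)⁻¹)}`).  The converse inclusion (P1) «`ker QSym(U′) ⊆ M(𝒯_{A₁}) + 𝒢_{U′}`» is what `hsplit` needs from the frame tower, and T2's characterisation
(✓`fderiv_logChartTwS_apply_eq_zero_iff_of_regPr`) + the covariance of the straight average (✓`QSym_gaugeDir_of_regPr`) reduce it to ONE linear equation on the fine gauge parameter `N`: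
with `λ_α(y) := D(v(·)(y))(A₁)α · v(A₁)(y)⁻¹` the response of the symmetric accumulated frames and `γ_N := M⁻¹(G_{U′}N)` the chart velocity of the gauge direction, the FRAME-CORRECTED operator
**`𝓚_{A₁} : N ↦ (y ↦ N(x̂_y) − λ_{γ_N}(y))`** must solve `𝓚_{A₁}(N) = −λ_{M⁻¹ξ}`; then `β := M⁻¹ξ − γ_N ∈ 𝒯_{A₁}` and `ξ = Mβ + G_{U′}N`.  At the background (`A₁ = 0`, `M = 1`) `𝓚₀` is the `k`-fold block
Ad-AVERAGE `N ↦ N⁽ᵏ⁾` (✓`Prop7SymFrameGaugeResponse` §4, ✓`Prop7SymAvgTwSGaugeDir.QTwS_gaugeDir_of_avgSeq`), onto coarse site fields; at `A₁ ≠ 0` its onto-ness is a Neumann perturbation whose constant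
(`D(eml)` away from `1`, summed down the tower) is an N06-class letter NOT in the tree — that, and Landau transversality at the chart point (P2), is the located residue of `hsplit`.

WHAT IS PROVED (sorry-free, no definition), in the setting of T2 §5 (`U₀ ∈ 𝔘_k(ε₀)`, `U′ ∈ 𝔘_k(ε₀′)`, `10¹²L³ε₀ ≤ 1`, `10⁹L²e ≤ 1`, `10⁷L³ε₀′ ≤ 1`, `‖A₁‖ < e·η`, `U′(b) = e^{A₁(b)}U₀(b)`):
§1 ★★★`fderiv_logChartTwS_sub_eq_zero_of_frameCorrected` — if `QSym U′ ξ = 0`, `Mβ₀ = ξ`, `Mγ = G_{U′}N` and `N(x̂_y) − λ_γ(y) = −λ_{β₀}(y)` at every comparison site, then `D(logChartTwS U₀)(A₁)(β₀ − γ) = 0`;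
§2 ★★★`exists_slice_tangent_add_gaugeDir_of_QSym_eq_zero` — the `hsplit`-shaped packaging: under the same solved equation, `∃ β N, D(logChartTwS U₀)(A₁)β = 0 ∧ ξ = Mβ + G_{U′}N`.
HONEST SCOPE: exact bookkeeping (no estimate); the solvability of `𝓚_{A₁}(N) = −λ_{M⁻¹ξ}` is the HYPOTHESIS, displayed, not proved; reality/𝔰𝔲(2)-valuedness of `β`, `N` for 𝔰𝔲(2) data is not
treated here (it follows by `θ`-averaging once the equation is solved in 𝔰𝔲(2), ✓`Prop7ChartVelocitySU2`); nothing of print is asserted.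

References: T. Bałaban, CMP 98 (1985) 17–51 [Balaban1985Averaging] ((11) p.19, (89)–(92) p.31, (97) p.32); CMP 99 (1985) 389–434 [Balaban1985BackgroundPropagators] ((3.19) p.393,
(3.21) p.394, (3.114)–(3.115) p.418); CMP 102 (1985) 277–309 [Balaban1985Variational] ((44)–(49) p.285, (82)–(83) p.290).
-/

set_option autoImplicit false

noncomputable section

open scoped BigOperators Matrix.Norms.L2Operator Matrix Topology RightActions
open Filter

namespace Summit.QuantumFields.YangMills.Theorems.Prop7TwistedSliceGaugeOnto

open NormedSpace
open Literature.MathematicalPhysics.QuantumFieldTheory.Balaban1983to89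
open Literature.MathematicalPhysics.QuantumFieldTheory.Balaban1983to89.T3ContinuumYM3Torus
open Literature.MathematicalPhysics.QuantumFieldTheory.Balaban1983to89.T3SectALandauChart (bgUnits eta eta_pos)
open Literature.MathematicalPhysics.QuantumFieldTheory.Balaban1983to89.T3PrintedRegularMinimiser (RegPr)
open B7Prop1Explicit (expUnit val_expUnit)
open Summit.QuantumFields.YangMills.Theorems.Prop7SymAvgGL (descendToGL)
open Summit.QuantumFields.YangMills.Theorems.Prop7SymAvgTwSym (frameTwS dbarTwS logChartTwS)
open Summit.QuantumFields.YangMills.Theorems.Prop7TwistedSliceTangent (fderiv_logChartTwS_apply_eq_zero_iff_of_regPr)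

section Onto

open Literature.Analysis.Calculus.ExpDifferential (ad gSer)
open T3LevelShift (siteShift)
open T3PrintedRegularOrbits (sites_eq)
open B15DeterminingSets (embIter)
open Summit.QuantumFields.YangMills.Theorems.Prop7SymAvgGL (QSym)
open Summit.QuantumFields.YangMills.Theorems.Prop7SymAvgRelDiffT3 (hasFDerivAt_rel_of_regPr QSym_gaugeDir_of_regPr)
open Summit.QuantumFields.YangMills.Theorems.Prop7SymAvgTwGaugeDir (hasFDerivAt_logChartSym)

variable (F : T3Family) {n K : ℕ} (h : n ≤ K)

/-- ★★★ **THE CONVERSE HALF OF THE `hsplit` TRANSPORT, GIVEN THE SOLVED FRAME-CORRECTED GAUGE EQUATION.**  In the setting of T2 §5, let `ξ ∈ ker QSym(U′)`, let `β₀` be its chart pre-velocity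
(`Mβ₀ = ξ`), and let the fine gauge parameter `N` with chart velocity `γ` (`Mγ = G_{U′}N`) solve `N(x̂_y) − λ_γ(y) = −λ_{β₀}(y)` at every comparison site `y` (`λ_α(y) = D(v(·)(y))(A₁)α·v(A₁)(y)⁻¹` the
frame response).  Then `β₀ − γ` is tangent to the twisted slice at `A₁`: `D(logChartTwS U₀)(A₁)(β₀ − γ) = 0`.  Proof: T2's characterisation for `β₀ − γ`; its left side is
`QSym U′ (ξ − G_{U′}N) = −(coarse gauge motion of N∘x̂)` (✓`QSym_gaugeDir_of_regPr`), its right side is the coarse gauge motion of `λ_{β₀} − λ_γ = −N∘x̂`.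
[cite: Balaban1985Averaging, (11) p.19, (97) p.32; Balaban1985BackgroundPropagators, (3.19) p.393, (3.114)-(3.115) p.418; Balaban1985Variational, (44)-(49) p.285] -/
theorem fderiv_logChartTwS_sub_eq_zero_of_frameCorrected {ε₀ ε₀' e : ℝ} (hε₀ : 0 < ε₀) (he : 0 < e) (hWe : 10 ^ 9 * (F.L : ℝ) ^ 2 * e ≤ 1)
    (hWε : 10 ^ 12 * (F.L : ℝ) ^ 3 * ε₀ ≤ 1) (hε₀' : 0 < ε₀') (hε' : 10 ^ 7 * (F.L : ℝ) ^ 3 * ε₀' ≤ 1)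
    (U₀ U' : GaugeField (F.P K) 0 (Matrix.specialUnitaryGroup (Fin 2) ℂ)) (hreg : RegPr F n K ε₀ U₀) (hreg' : RegPr F n K ε₀' U')
    (A₁ : PBond (F.P K) 0 → Matrix (Fin 2) (Fin 2) ℂ) (hA₁ : ‖A₁‖ < e * eta F n K)
    (hU' : ∀ b, ((U' b : Matrix.specialUnitaryGroup (Fin 2) ℂ) : Matrix (Fin 2) (Fin 2) ℂ) = exp (A₁ b) * ((U₀ b : Matrix.specialUnitaryGroup (Fin 2) ℂ) : Matrix (Fin 2) (Fin 2) ℂ))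
    (ξ β₀ γ : PBond (F.P K) 0 → Matrix (Fin 2) (Fin 2) ℂ) (N : Site (F.P K) 0 → Matrix (Fin 2) (Fin 2) ℂ) (hξ : QSym F n K h U' ξ = 0)
    (hβ₀ : ∀ b, gSer ℂ (ad ℂ (-A₁ b)) (β₀ b) = ξ b)
    (hγ : ∀ b, gSer ℂ (ad ℂ (-A₁ b)) (γ b) = N b.src - ((bgUnits F K U' b : (Matrix (Fin 2) (Fin 2) ℂ)ˣ) : Matrix (Fin 2) (Fin 2) ℂ) * N b.tgt *
        (((bgUnits F K U' b)⁻¹ : (Matrix (Fin 2) (Fin 2) ℂ)ˣ) : Matrix (Fin 2) (Fin 2) ℂ))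
    (hN : ∀ y : Site (F.P n) 0, N (embIter (K - n) (siteShift (sites_eq F n K h) y))
        - fderiv ℂ (fun A : PBond (F.P K) 0 → Matrix (Fin 2) (Fin 2) ℂ => ((frameTwS F n K h U₀ A y : (Matrix (Fin 2) (Fin 2) ℂ)ˣ) : Matrix (Fin 2) (Fin 2) ℂ)) A₁ γ *
            (((frameTwS F n K h U₀ A₁ y)⁻¹ : (Matrix (Fin 2) (Fin 2) ℂ)ˣ) : Matrix (Fin 2) (Fin 2) ℂ)
        = -(fderiv ℂ (fun A : PBond (F.P K) 0 → Matrix (Fin 2) (Fin 2) ℂ => ((frameTwS F n K h U₀ A y : (Matrix (Fin 2) (Fin 2) ℂ)ˣ) : Matrix (Fin 2) (Fin 2) ℂ)) A₁ β₀ *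
            (((frameTwS F n K h U₀ A₁ y)⁻¹ : (Matrix (Fin 2) (Fin 2) ℂ)ˣ) : Matrix (Fin 2) (Fin 2) ℂ))) :
    fderiv ℂ (logChartTwS F n K h U₀) A₁ (β₀ - γ) = 0 := by
  apply (fderiv_logChartTwS_apply_eq_zero_iff_of_regPr F h hε₀ he hWe hWε hε₀' hε' U₀ U' hreg hreg' A₁ hA₁ hU' (β₀ - γ)).2
  intro c
  -- the velocity of `β₀ − γ` is `ξ − G_{U′}N`
  have hM : (fun b : PBond (F.P K) 0 => gSer ℂ (ad ℂ (-A₁ b)) ((β₀ - γ) b))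
      = ξ - fun b : PBond (F.P K) 0 => N b.src - ((bgUnits F K U' b : (Matrix (Fin 2) (Fin 2) ℂ)ˣ) : Matrix (Fin 2) (Fin 2) ℂ) * N b.tgt *
          (((bgUnits F K U' b)⁻¹ : (Matrix (Fin 2) (Fin 2) ℂ)ˣ) : Matrix (Fin 2) (Fin 2) ℂ) := by
    funext b
    rw [Pi.sub_apply, map_sub, hβ₀, hγ, Pi.sub_apply]
  -- `QSym U′` is the derivative of the `U′`-based relative average
  have hG := hasFDerivAt_rel_of_regPr F h hε₀' hε' U' hreg'
  have hQ : QSym F n K h U' = fderiv ℂ (fun A : PBond (F.P K) 0 → Matrix (Fin 2) (Fin 2) ℂ => fun c : PBond (F.P n) 0 =>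
        ((descendToGL F n K h (fun b => expUnit (A b) * bgUnits F K U' b) c : (Matrix (Fin 2) (Fin 2) ℂ)ˣ) : Matrix (Fin 2) (Fin 2) ℂ) *
          (((descendToGL F n K h (bgUnits F K U') c)⁻¹ : (Matrix (Fin 2) (Fin 2) ℂ)ˣ) : Matrix (Fin 2) (Fin 2) ℂ)) 0 :=
    (hasFDerivAt_logChartSym F h U' hG).fderiv
  have hgauge := QSym_gaugeDir_of_regPr F h hε₀' hε' U' hreg' N
  -- the frame responses are linear in the direction
  have hlin : ∀ y : Site (F.P n) 0,
      fderiv ℂ (fun A : PBond (F.P K) 0 → Matrix (Fin 2) (Fin 2) ℂ => ((frameTwS F n K h U₀ A y : (Matrix (Fin 2) (Fin 2) ℂ)ˣ) : Matrix (Fin 2) (Fin 2) ℂ)) A₁ (β₀ - γ) *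
          (((frameTwS F n K h U₀ A₁ y)⁻¹ : (Matrix (Fin 2) (Fin 2) ℂ)ˣ) : Matrix (Fin 2) (Fin 2) ℂ)
        = -N (embIter (K - n) (siteShift (sites_eq F n K h) y)) := by
    intro y
    rw [map_sub, sub_mul, sub_eq_iff_eq_add.mp (hN y)]
    abel
  rw [hM, ← hQ, map_sub, hξ, hgauge, zero_sub, Pi.neg_apply, hlin c.src, hlin c.tgt, neg_sub, sub_mul]
  simp only [mul_assoc, Units.inv_mul_cancel_left, neg_mul, mul_neg, sub_neg_eq_add]
  abel

/-- ★★★ **`hsplit`-SHAPED PACKAGING: `ker QSym(U′) ⊆ M·𝒯_{A₁} + 𝒢_{U′}` ONCE `𝓚_{A₁}(N) = −λ_{M⁻¹ξ}` IS SOLVED.**  In the setting of T2 §5: if `QSym U′ ξ = 0`, `Mβ₀ = ξ`, and some fine gauge parameter `N`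
with chart velocity `γ` (`Mγ = G_{U′}N`) solves the frame-corrected gauge equation `N(x̂_y) − λ_γ(y) = −λ_{β₀}(y)` at the comparison sites, then `ξ` splits as a twisted-slice-tangent velocity plus a
gauge direction at `U′`: `∃ β N, D(logChartTwS U₀)(A₁)β = 0 ∧ ξ = Mβ + G_{U′}N` (`β := β₀ − γ`).  The solvability hypothesis is print's «`Q′` maps onto the coarse gauge parameters» at the chart point;
at `A₁ = 0` the operator is the `k`-fold block Ad-average ([Balaban1985BackgroundPropagators] (3.19)), at `A₁ ≠ 0` its onto-ness is the located N06-class residue of the row.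
[cite: Balaban1985Averaging, (11) p.19, (97) p.32; Balaban1985BackgroundPropagators, (3.19) p.393, (3.21) p.394, (3.114)-(3.115) p.418; Balaban1985Variational, (44)-(49) p.285, (82)-(83) p.290] -/
theorem exists_slice_tangent_add_gaugeDir_of_QSym_eq_zero {ε₀ ε₀' e : ℝ} (hε₀ : 0 < ε₀) (he : 0 < e) (hWe : 10 ^ 9 * (F.L : ℝ) ^ 2 * e ≤ 1)
    (hWε : 10 ^ 12 * (F.L : ℝ) ^ 3 * ε₀ ≤ 1) (hε₀' : 0 < ε₀') (hε' : 10 ^ 7 * (F.L : ℝ) ^ 3 * ε₀' ≤ 1)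
    (U₀ U' : GaugeField (F.P K) 0 (Matrix.specialUnitaryGroup (Fin 2) ℂ)) (hreg : RegPr F n K ε₀ U₀) (hreg' : RegPr F n K ε₀' U')
    (A₁ : PBond (F.P K) 0 → Matrix (Fin 2) (Fin 2) ℂ) (hA₁ : ‖A₁‖ < e * eta F n K)
    (hU' : ∀ b, ((U' b : Matrix.specialUnitaryGroup (Fin 2) ℂ) : Matrix (Fin 2) (Fin 2) ℂ) = exp (A₁ b) * ((U₀ b : Matrix.specialUnitaryGroup (Fin 2) ℂ) : Matrix (Fin 2) (Fin 2) ℂ))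
    (ξ β₀ : PBond (F.P K) 0 → Matrix (Fin 2) (Fin 2) ℂ) (hξ : QSym F n K h U' ξ = 0) (hβ₀ : ∀ b, gSer ℂ (ad ℂ (-A₁ b)) (β₀ b) = ξ b)
    (hK : ∃ (N : Site (F.P K) 0 → Matrix (Fin 2) (Fin 2) ℂ) (γ : PBond (F.P K) 0 → Matrix (Fin 2) (Fin 2) ℂ),
      (∀ b, gSer ℂ (ad ℂ (-A₁ b)) (γ b) = N b.src - ((bgUnits F K U' b : (Matrix (Fin 2) (Fin 2) ℂ)ˣ) : Matrix (Fin 2) (Fin 2) ℂ) * N b.tgt *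
          (((bgUnits F K U' b)⁻¹ : (Matrix (Fin 2) (Fin 2) ℂ)ˣ) : Matrix (Fin 2) (Fin 2) ℂ)) ∧
      ∀ y : Site (F.P n) 0, N (embIter (K - n) (siteShift (sites_eq F n K h) y))
          - fderiv ℂ (fun A : PBond (F.P K) 0 → Matrix (Fin 2) (Fin 2) ℂ => ((frameTwS F n K h U₀ A y : (Matrix (Fin 2) (Fin 2) ℂ)ˣ) : Matrix (Fin 2) (Fin 2) ℂ)) A₁ γ *
              (((frameTwS F n K h U₀ A₁ y)⁻¹ : (Matrix (Fin 2) (Fin 2) ℂ)ˣ) : Matrix (Fin 2) (Fin 2) ℂ)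
          = -(fderiv ℂ (fun A : PBond (F.P K) 0 → Matrix (Fin 2) (Fin 2) ℂ => ((frameTwS F n K h U₀ A y : (Matrix (Fin 2) (Fin 2) ℂ)ˣ) : Matrix (Fin 2) (Fin 2) ℂ)) A₁ β₀ *
              (((frameTwS F n K h U₀ A₁ y)⁻¹ : (Matrix (Fin 2) (Fin 2) ℂ)ˣ) : Matrix (Fin 2) (Fin 2) ℂ))) :
    ∃ (β : PBond (F.P K) 0 → Matrix (Fin 2) (Fin 2) ℂ) (N : Site (F.P K) 0 → Matrix (Fin 2) (Fin 2) ℂ),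
      fderiv ℂ (logChartTwS F n K h U₀) A₁ β = 0 ∧
      ∀ b, ξ b = gSer ℂ (ad ℂ (-A₁ b)) (β b) + (N b.src - ((bgUnits F K U' b : (Matrix (Fin 2) (Fin 2) ℂ)ˣ) : Matrix (Fin 2) (Fin 2) ℂ) * N b.tgt *
          (((bgUnits F K U' b)⁻¹ : (Matrix (Fin 2) (Fin 2) ℂ)ˣ) : Matrix (Fin 2) (Fin 2) ℂ)) := by
  obtain ⟨N, γ, hγ, hN⟩ := hK
  refine ⟨β₀ - γ, N, fderiv_logChartTwS_sub_eq_zero_of_frameCorrected F h hε₀ he hWe hWε hε₀' hε' U₀ U' hreg hreg' A₁ hA₁ hU' ξ β₀ γ N hξ hβ₀ hγ hN, fun b => ?_⟩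
  rw [Pi.sub_apply, map_sub, hβ₀, hγ, sub_add_cancel]

end Onto

end Summit.QuantumFields.YangMills.Theorems.Prop7TwistedSliceGaugeOnto

end
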